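import Summits.ABC.IUTFork.Conditional.WRowUnconditionalPackages
import Summits.ABC.IUTFork.Cor312LicenceWildInhabitedGenuineK
import Literature.IUT.LogVolume.GenuineLogThetaPointGalois
import HarnessLib

/-!
# The bad fibre of the `K`-level Dupuy–Hilado datum of a genuine Θ-volume datum over a `λ`-line point of ANY degree:
# conjugacy over `F_tpd`, the q-degree and the local type read off the place of `F_tpd` below

PROOF-ONLY file (D-0012; 0 definitions, 0 `Prop` facts) of the abc-iut cell — D-0079 RESCUE sub-cell R-W «WINDOW Θ-SIDE INEQUALITY», W1 ROW
DECISIONS seat abc-iut-W-row-2 (gen 3). It lifts the rational-point tools of abc-iut-W-row-1's socket `Cor312LicenceTripleUnconditional`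
(`d_mod = 1`: ONE place of `F_mod` over `p`, so the whole bad fibre over `p` is conjugate) to a point `P = (F_tpd, λ)` of the `λ`-line over a
number field of ANY degree, where the bad fibre over `p` splits into TYPES indexed by the places of `F_tpd` over `p` — the shape consumed by
abc-iut-w5-d180's MIXED-FIBRE socket (`Cor312LicenceWildInhabitedMixed`, p476904) and by this seat's rows 9/10 of HOME/plan/rescue/R-W/OPEN-10.md
(the Broberg datum over `ℚ(√7)`). TAKES NO SIDE on [IUTchIII] Cor. 3.12 (S. Mochizuki, *Inter-universal Teichmüller theory III*, Cor. 3.12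
p. 173–174) or on any author.

WHAT IS PROVED (namespace `Summit.ABC.IUTFork.Conditional`; `T : Cor22.ThetaVolumeDatumAt P l` a genuine Θ-volume datum ([IUTchIV] Cor. 2.2 (ii)
proof (P7)), `X := pilotDataOfK T.D T.K`, `x | p` a fibre point, `u = placeOf X p x` its place of `K`, `w = u ∩ 𝓞_F`, `v = w ∩ 𝓞_{F_tpd}`):
* `GenuineK.isGalois_tpd_K` — **`K/F_tpd` is Galois** ([IUTchI] Rmk. 3.1.5 `K/F_mod` Galois, abc-iut-L5 lineage's
  `InitialThetaData.isGalois_fieldOfModuli_K`; `F_mod = ℚ(j(E_F)) = ℚ(j(λ))` lies inside the image of `F_tpd`, the argument of abc-iut-S3's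
  `Cor22.ThetaVolumeDatumAt.isGalois_tpd` one floor up);
* `GenuineK.exists_algEquiv_kOf_norm_eq_of_finBelow_tpd_eq` / `…absRamificationIdx_kOf_eq_of_finBelow_tpd_eq` /
  `…nonempty_algEquiv_kOf_of_finBelow_tpd_eq` — **two fibre points over the SAME place of `F_tpd` have `ℚ_p`-isometric completions**, hence the
  same `e(K_x/ℚ_p)` (Cassels–Fröhlich VII Prop. 1.2 (ii); abc-iut-w5-d056's `RescaledCompletion.exists_algEquiv_norm_eq_of_under_eq`);
* `GenuineK.finBelow_tpd_mem_badPlaces` / `GenuineK.natCast_mem_finBelow_tpd` — a BAD fibre point lies over a pole of `j(λ)` in `F_tpd`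
  (`ord_v j(λ) < 0`), and `v | p`;
* `GenuineK.qPilot_placeOf_eq_of_ord_tpd` — **`P_q(x) = e(K_x/ℚ_p)·h/(2l)`** at a bad `x` over a place `v` of `F_tpd` UNRAMIFIED over `p` with
  `ord_v j(λ) = −h` (Dupuy–Hilado §3.3: `ord_u(q) = −ord_u(j_E) = e(u|v)·h`);
* `GenuineK.exists_absRamificationIdx_kOf_eq_prime_mul_tpd` — there, **`e(K_x/ℚ_p) = l·m` with `30 ∣ m·h`** (`m = e(w|v)`: the `l`-division
  layer contributes exactly `l`, abc-iut-W-neg-1's `ThetaVolumeDatumAt.ramificationIdx_int_eq_mul_prime`; the `30`-th root of the Tate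
  parameter in `F_w`, `ThetaVolumeDatumAt.thirty_dvd_ramificationIdx_mul_ord`).
READING (neutral): bookkeeping of OUR typed data; with `(p−1) ∣ e` at `p ∣ 30` (`GenuineK.sub_one_dvd_absRamificationIdx_kOf`) these are ALL the
inputs the mixed socket takes BY NAME at a quadratic point with unramified bad primes. Classical algebraic number theory; nothing here bears
on the truth of Cor. 3.12; typed ≠ proved; instantiated ≠ endorsed; no abc claim.
[cite: Mochizuki2012, IUTchI Def. 3.1 (b),(c) pp. 61–62, Rmk. 3.1.5 p. 65, Ex. 3.2 (iv) p. 71; IUTchIV Cor. 2.2 (ii) proof (P5),(P7) p. 46]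
[cite: DupuyHilado2025, §3.3, §3.4] [cite: CasselsFrohlichANT1967, Ch. VII Prop. 1.2 (ii)] [cite: NeukirchANT1999, Ch. I (8.2), Ch. II (6.8)]
[cite: SilvermanATAEC1994, V.5 Thm. 5.3 and Cor. 5.4] [claim: Mochizuki2012, status: disputed] for every IUT sentence.
-/

noncomputable section

open NumberField IsDedekindDomain

namespace Summit.ABC.IUTFork.Conditional

open Thm311 Thm311.Real Cor312 Cor312Prov Literature.IUT.LogVolume Literature.IUT.HodgeTheaters
  Literature.IUT.LogThetaLattice Literature.NumberTheory.NumberFields Literature.NumberTheory.DiophantineGeometry.GenEll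
  Literature.NumberTheory.DiophantineGeometry

/-! ## §1. `K/F_tpd` is Galois; conjugacy of fibre points over one place of `F_tpd` -/

/-- **`K/F_tpd` is Galois** for every genuine Θ-volume datum `T` at `(P, l)` (the composite algebra `F_tpd → F → K`): `K/F_mod` is Galois
([IUTchI] Rmk. 3.1.5) and `F_mod = ℚ(j(E_F))` is the image of `ℚ(j(λ)) ⊆ F_tpd` (`T.j_eq`), so `F_tpd` is an intermediate field.
[cite: Mochizuki2012, IUTchI Rmk. 3.1.5 p. 65] [claim: Mochizuki2012, status: disputed] -/
theorem GenuineK.isGalois_tpd_K {P : NFPoint} {l : ℕ} (T : Cor22.ThetaVolumeDatumAt P l) :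
    letI := T.instFieldF; letI := T.instNumberFieldF; letI := T.instAlgebraF; letI := T.instFieldK
    letI := T.instNumberFieldK; letI := T.instAlgebraK
    letI : Algebra P.F T.K := ((algebraMap T.F T.K).comp (algebraMap P.F T.F)).toAlgebra
    IsGalois P.F T.K := by
  letI := T.instFieldF; letI := T.instNumberFieldF; letI := T.instAlgebraF; letI := T.instFieldK
  letI := T.instNumberFieldK; letI := T.instAlgebraK; letI := T.instFieldFbar; letI := T.instAlgebraFbar
  letI := T.instAlgebraKFbar; letI := T.instIsElliptic
  letI : Algebra P.F T.K := ((algebraMap T.F T.K).comp (algebraMap P.F T.F)).toAlgebra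
  haveI : IsScalarTower P.F T.F T.K := IsScalarTower.of_algebraMap_eq fun _ => rfl
  haveI : IsGalois (fieldOfModuli T.E) T.K := T.isGalois_fieldOfModuli_K
  -- `F_mod = (ℚ(j(λ)) ⊆ F_tpd).map (F_tpd → F)`
  let φ : P.F →ₐ[ℚ] T.F := IsScalarTower.toAlgHom ℚ P.F T.F
  set M₀ : IntermediateField ℚ P.F := IntermediateField.adjoin ℚ {Cor22.jInv P.x} with hM₀
  have hfm : fieldOfModuli T.E = M₀.map φ := by
    rw [fieldOfModuli, T.j_eq, hM₀, IntermediateField.adjoin_map, Set.image_singleton]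
    rfl
  let e : M₀ ≃ₐ[ℚ] fieldOfModuli T.E :=
    (IntermediateField.equivMap M₀ φ).trans (IntermediateField.equivOfEq hfm.symm)
  -- the `F_mod`-algebra structure on `F_tpd` through `e⁻¹`
  letI : Algebra (fieldOfModuli T.E) P.F :=
    ((M₀.val : M₀ →ₐ[ℚ] P.F).comp (e.symm : fieldOfModuli T.E →ₐ[ℚ] M₀)).toRingHom.toAlgebra
  have hFF : ∀ y : fieldOfModuli T.E,
      algebraMap (fieldOfModuli T.E) T.F y = algebraMap P.F T.F (algebraMap (fieldOfModuli T.E) P.F y) := by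
    intro y
    obtain ⟨x, rfl⟩ := e.surjective y
    change ((e x : fieldOfModuli T.E) : T.F) = algebraMap P.F T.F ((M₀.val : M₀ →ₐ[ℚ] P.F) (e.symm (e x)))
    rw [e.symm_apply_apply]
    change ((e x : fieldOfModuli T.E) : T.F) = φ (x : P.F)
    rfl
  haveI : IsScalarTower (fieldOfModuli T.E) P.F T.K := by
    refine IsScalarTower.of_algebraMap_eq fun y => ?_
    rw [IsScalarTower.algebraMap_apply (fieldOfModuli T.E) T.F T.K, hFF y]
    rfl
  exact IsGalois.tower_top_of_isGalois (fieldOfModuli T.E) P.F T.K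

/-- **CONJUGACY OF THE FIBRE OVER ONE PLACE OF `F_tpd`.** Two fibre points `x, y` of `pilotDataOfK T.D T.K` over `p` whose places of `K` lie
over the SAME place of `F_tpd` have `ℚ_p`-ISOMETRIC completions (`K/F_tpd` Galois, the decomposition of Galois conjugates; abc-iut-w5-d056's
`RescaledCompletion.exists_algEquiv_norm_eq_of_under_eq`). [cite: CasselsFrohlichANT1967, Ch. VII Prop. 1.2 (ii)] -/
theorem GenuineK.exists_algEquiv_kOf_norm_eq_of_finBelow_tpd_eq {P : NFPoint} {l : ℕ} (T : Cor22.ThetaVolumeDatumAt P l)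
    (pp : Nat.Primes) :
    letI := T.instFieldF; letI := T.instNumberFieldF; letI := T.instAlgebraF; letI := T.instFieldK
    letI := T.instNumberFieldK; letI := T.instAlgebraK; letI := T.instFieldFbar; letI := T.instAlgebraFbar
    letI := T.instAlgebraKFbar; letI := T.instIsElliptic
    haveI : Fact (pp : ℕ).Prime := ⟨pp.2⟩
    ∀ x y : (thetaIndex (pilotDataOfK T.D T.K)).Fibre (.inr pp),
      finBelow P.F T.F (finBelow T.F T.K (placeOf (pilotDataOfK T.D T.K) pp.1 x)) =
        finBelow P.F T.F (finBelow T.F T.K (placeOf (pilotDataOfK T.D T.K) pp.1 y)) →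
      ∃ g : kOf (pilotDataOfK T.D T.K) pp.1 x ≃ₐ[ℚ_[pp]] kOf (pilotDataOfK T.D T.K) pp.1 y, ∀ z, ‖g z‖ = ‖z‖ := by
  letI := T.instFieldF; letI := T.instNumberFieldF; letI := T.instAlgebraF; letI := T.instFieldK
  letI := T.instNumberFieldK; letI := T.instAlgebraK; letI := T.instFieldFbar; letI := T.instAlgebraFbar
  letI := T.instAlgebraKFbar; letI := T.instIsElliptic
  haveI : Fact (pp : ℕ).Prime := ⟨pp.2⟩
  set X := pilotDataOfK T.D T.K with hXdef
  intro x y h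
  letI : Algebra P.F T.K := ((algebraMap T.F T.K).comp (algebraMap P.F T.F)).toAlgebra
  haveI : IsScalarTower P.F T.F T.K := IsScalarTower.of_algebraMap_eq fun _ => rfl
  haveI : IsGalois P.F T.K := GenuineK.isGalois_tpd_K T
  have hunder : (placeOf X pp.1 x).asIdeal.under (𝓞 P.F) = (placeOf X pp.1 y).asIdeal.under (𝓞 P.F) := by
    have h' := congrArg HeightOneSpectrum.asIdeal h
    change ((placeOf X pp.1 x).asIdeal.under (𝓞 T.F)).under (𝓞 P.F) =
      ((placeOf X pp.1 y).asIdeal.under (𝓞 T.F)).under (𝓞 P.F) at h'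
    rwa [Ideal.under_under, Ideal.under_under] at h'
  have hunder' : (placeOf X pp.1 x).under (𝓞 P.F) = (placeOf X pp.1 y).under (𝓞 P.F) := by
    rw [← finBelow_eq_under P.F T.K, ← finBelow_eq_under P.F T.K]
    exact HeightOneSpectrum.ext hunder
  exact RescaledCompletion.exists_algEquiv_norm_eq_of_under_eq (F₀ := P.F) (p := (pp : ℕ))
    (placeOf X pp.1 x) (placeOf X pp.1 y) (natCast_mem_placeOf X pp.1 x) (natCast_mem_placeOf X pp.1 y) hunder'

/-- **Uniform ramification over one place of `F_tpd`**: fibre points over the same place of `F_tpd` have the same `e(K_x/ℚ_p)`.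
[cite: CasselsFrohlichANT1967, Ch. VII §1.1, Prop. 1.2 (ii)] -/
theorem GenuineK.absRamificationIdx_kOf_eq_of_finBelow_tpd_eq {P : NFPoint} {l : ℕ} (T : Cor22.ThetaVolumeDatumAt P l)
    (pp : Nat.Primes) :
    letI := T.instFieldF; letI := T.instNumberFieldF; letI := T.instAlgebraF; letI := T.instFieldK
    letI := T.instNumberFieldK; letI := T.instAlgebraK; letI := T.instFieldFbar; letI := T.instAlgebraFbar
    letI := T.instAlgebraKFbar; letI := T.instIsElliptic
    haveI : Fact (pp : ℕ).Prime := ⟨pp.2⟩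
    ∀ x y : (thetaIndex (pilotDataOfK T.D T.K)).Fibre (.inr pp),
      finBelow P.F T.F (finBelow T.F T.K (placeOf (pilotDataOfK T.D T.K) pp.1 x)) =
        finBelow P.F T.F (finBelow T.F T.K (placeOf (pilotDataOfK T.D T.K) pp.1 y)) →
      absRamificationIdx (pp : ℕ) (kOf (pilotDataOfK T.D T.K) pp.1 x) =
        absRamificationIdx (pp : ℕ) (kOf (pilotDataOfK T.D T.K) pp.1 y) := by
  letI := T.instFieldF; letI := T.instNumberFieldF; letI := T.instAlgebraF; letI := T.instFieldK
  letI := T.instNumberFieldK; letI := T.instAlgebraK; letI := T.instFieldFbar; letI := T.instAlgebraFbar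
  letI := T.instAlgebraKFbar; letI := T.instIsElliptic
  haveI : Fact (pp : ℕ).Prime := ⟨pp.2⟩
  set X := pilotDataOfK T.D T.K with hXdef
  intro x y h
  obtain ⟨g, hg⟩ := GenuineK.exists_algEquiv_kOf_norm_eq_of_finBelow_tpd_eq T pp x y h
  exact WRow.absRamificationIdx_eq_of_algEquiv_norm_eq (pp : ℕ) g hg

/-- **The mixed socket's `hiso` over one place of `F_tpd`**: fibre points over the same place of `F_tpd` have `ℚ_p`-isomorphic
completions. [cite: CasselsFrohlichANT1967, Ch. VII Prop. 1.2 (ii)] -/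
theorem GenuineK.nonempty_algEquiv_kOf_of_finBelow_tpd_eq {P : NFPoint} {l : ℕ} (T : Cor22.ThetaVolumeDatumAt P l)
    (pp : Nat.Primes) :
    letI := T.instFieldF; letI := T.instNumberFieldF; letI := T.instAlgebraF; letI := T.instFieldK
    letI := T.instNumberFieldK; letI := T.instAlgebraK; letI := T.instFieldFbar; letI := T.instAlgebraFbar
    letI := T.instAlgebraKFbar; letI := T.instIsElliptic
    haveI : Fact (pp : ℕ).Prime := ⟨pp.2⟩
    ∀ x y : (thetaIndex (pilotDataOfK T.D T.K)).Fibre (.inr pp),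
      finBelow P.F T.F (finBelow T.F T.K (placeOf (pilotDataOfK T.D T.K) pp.1 x)) =
        finBelow P.F T.F (finBelow T.F T.K (placeOf (pilotDataOfK T.D T.K) pp.1 y)) →
      Nonempty (kOf (pilotDataOfK T.D T.K) pp.1 x ≃ₐ[ℚ_[pp]] kOf (pilotDataOfK T.D T.K) pp.1 y) := by
  letI := T.instFieldF; letI := T.instNumberFieldF; letI := T.instAlgebraF; letI := T.instFieldK
  letI := T.instNumberFieldK; letI := T.instAlgebraK; letI := T.instFieldFbar; letI := T.instAlgebraFbar
  letI := T.instAlgebraKFbar; letI := T.instIsElliptic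
  haveI : Fact (pp : ℕ).Prime := ⟨pp.2⟩
  set X := pilotDataOfK T.D T.K with hXdef
  intro x y h
  obtain ⟨g, -⟩ := GenuineK.exists_algEquiv_kOf_norm_eq_of_finBelow_tpd_eq T pp x y h
  exact ⟨g⟩

/-! ## §2. A bad fibre point lies over a pole of `j(λ)` in `F_tpd`, over `p` -/

/-- **A BAD fibre point lies over a pole of `j(λ)`**: `x | p` bad ⇒ the place `v` of `F_tpd` under it is in `Cor22.badPlaces P`
(`ord_u(j_E) < 0` at `u ∈ S`, [IUTchI] Def. 3.1 (b); `j_E = j(λ)` read along `F_tpd → F → K`; `ord_u = e(u|v)·ord_v`).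
[cite: Mochizuki2012, IUTchI Def. 3.1 (b) p. 61] [cite: NeukirchANT1999, Ch. I (8.2)] -/
theorem GenuineK.finBelow_tpd_mem_badPlaces {P : NFPoint} {l : ℕ} (T : Cor22.ThetaVolumeDatumAt P l) (pp : Nat.Primes) :
    letI := T.instFieldF; letI := T.instNumberFieldF; letI := T.instAlgebraF; letI := T.instFieldK
    letI := T.instNumberFieldK; letI := T.instAlgebraK; letI := T.instFieldFbar; letI := T.instAlgebraFbar
    letI := T.instAlgebraKFbar; letI := T.instIsElliptic
    haveI : Fact (pp : ℕ).Prime := ⟨pp.2⟩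
    ∀ x : (thetaIndex (pilotDataOfK T.D T.K)).Fibre (.inr pp),
      placeOf (pilotDataOfK T.D T.K) pp.1 x ∈ (pilotDataOfK T.D T.K).S →
      finBelow P.F T.F (finBelow T.F T.K (placeOf (pilotDataOfK T.D T.K) pp.1 x)) ∈ Cor22.badPlaces P := by
  letI := T.instFieldF; letI := T.instNumberFieldF; letI := T.instAlgebraF; letI := T.instFieldK
  letI := T.instNumberFieldK; letI := T.instAlgebraK; letI := T.instFieldFbar; letI := T.instAlgebraFbar
  letI := T.instAlgebraKFbar; letI := T.instIsElliptic
  haveI : Fact (pp : ℕ).Prime := ⟨pp.2⟩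
  set X := pilotDataOfK T.D T.K with hXdef
  intro x hx
  letI : Algebra P.F T.K := ((algebraMap T.F T.K).comp (algebraMap P.F T.F)).toAlgebra
  haveI : IsScalarTower P.F T.F T.K := IsScalarTower.of_algebraMap_eq fun _ => rfl
  set u := placeOf X pp.1 x with hudef
  have hneg := X.ord_jE_neg u hx
  have hjK : X.jE = algebraMap P.F T.K (Cor22.jInv P.x) := by
    rw [show X.jE = algebraMap T.F T.K T.E.j from rfl, T.j_eq, ← IsScalarTower.algebraMap_apply]
  rw [hjK, Cor22.ord_algebraMap_neg_iff u (Cor22.jInv P.x)] at hneg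
  have hfb : finBelow P.F T.K u = finBelow P.F T.F (finBelow T.F T.K u) :=
    HeightOneSpectrum.ext (Ideal.under_under (B := 𝓞 T.F) u.asIdeal).symm
  rw [hfb] at hneg
  exact (Cor22.mem_badPlaces_iff_ord_neg P _).mpr hneg

/-- The place of `F_tpd` under a fibre point `x | p` lies over `p`. [folklore] -/
theorem GenuineK.natCast_mem_finBelow_tpd {P : NFPoint} {l : ℕ} (T : Cor22.ThetaVolumeDatumAt P l) (pp : Nat.Primes) :
    letI := T.instFieldF; letI := T.instNumberFieldF; letI := T.instAlgebraF; letI := T.instFieldK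
    letI := T.instNumberFieldK; letI := T.instAlgebraK; letI := T.instFieldFbar; letI := T.instAlgebraFbar
    letI := T.instAlgebraKFbar; letI := T.instIsElliptic
    haveI : Fact (pp : ℕ).Prime := ⟨pp.2⟩
    ∀ x : (thetaIndex (pilotDataOfK T.D T.K)).Fibre (.inr pp),
      ((pp : ℕ) : 𝓞 P.F) ∈ (finBelow P.F T.F (finBelow T.F T.K (placeOf (pilotDataOfK T.D T.K) pp.1 x))).asIdeal := by
  letI := T.instFieldF; letI := T.instNumberFieldF; letI := T.instAlgebraF; letI := T.instFieldK
  letI := T.instNumberFieldK; letI := T.instAlgebraK; letI := T.instFieldFbar; letI := T.instAlgebraFbar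
  letI := T.instAlgebraKFbar; letI := T.instIsElliptic
  haveI : Fact (pp : ℕ).Prime := ⟨pp.2⟩
  set X := pilotDataOfK T.D T.K with hXdef
  intro x
  rw [Cor22.natCast_mem_asIdeal_finBelow_iff, Cor22.natCast_mem_asIdeal_finBelow_iff]
  exact natCast_mem_placeOf (pilotDataOfK T.D T.K) pp.1 x

/-! ## §3. The q-degree and the local type at a bad fibre point over an UNRAMIFIED place of `F_tpd` -/

/-- **`P_q(x) = e(K_x/ℚ_p)·h/(2l)` at a bad fibre point `x | p` over a place `v` of `F_tpd` UNRAMIFIED over `p` with `ord_v j(λ) = −h`**: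
`P_q(u) = ord_u(q)/(2l)`, `ord_u(q) = −ord_u(j_E) = e(u|v)·h` (Dupuy–Hilado §3.3; `ord_u = e(u|v)·ord_v`), and `e(K_x/ℚ_p) = e(v|p)·e(u|v) = e(u|v)`.
[cite: DupuyHilado2025, §3.3, §3.4] [cite: NeukirchANT1999, Ch. I (8.2), Ch. II (6.8)] -/
theorem GenuineK.qPilot_placeOf_eq_of_ord_tpd {P : NFPoint} {l : ℕ} (T : Cor22.ThetaVolumeDatumAt P l) (pp : Nat.Primes) :
    letI := T.instFieldF; letI := T.instNumberFieldF; letI := T.instAlgebraF; letI := T.instFieldK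
    letI := T.instNumberFieldK; letI := T.instAlgebraK; letI := T.instFieldFbar; letI := T.instAlgebraFbar
    letI := T.instAlgebraKFbar; letI := T.instIsElliptic
    haveI : Fact (pp : ℕ).Prime := ⟨pp.2⟩
    ∀ (x : (thetaIndex (pilotDataOfK T.D T.K)).Fibre (.inr pp)) {e h : ℕ},
      placeOf (pilotDataOfK T.D T.K) pp.1 x ∈ (pilotDataOfK T.D T.K).S →
      absRamificationIdx (pp : ℕ) (kOf (pilotDataOfK T.D T.K) pp.1 x) = e →
      ramIdx P.F (finBelow P.F T.F (finBelow T.F T.K (placeOf (pilotDataOfK T.D T.K) pp.1 x))) = 1 →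
      ord P.F (finBelow P.F T.F (finBelow T.F T.K (placeOf (pilotDataOfK T.D T.K) pp.1 x))) (Cor22.jInv P.x) = -(h : ℤ) →
      (pilotDataOfK T.D T.K).qPilot (placeOf (pilotDataOfK T.D T.K) pp.1 x) = (e : ℝ) * h / (2 * l) := by
  letI := T.instFieldF; letI := T.instNumberFieldF; letI := T.instAlgebraF; letI := T.instFieldK
  letI := T.instNumberFieldK; letI := T.instAlgebraK; letI := T.instFieldFbar; letI := T.instAlgebraFbar
  letI := T.instAlgebraKFbar; letI := T.instIsElliptic
  haveI : Fact (pp : ℕ).Prime := ⟨pp.2⟩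
  set X := pilotDataOfK T.D T.K with hXdef
  intro x e h hx he hv1 hord
  letI : Algebra P.F T.K := ((algebraMap T.F T.K).comp (algebraMap P.F T.F)).toAlgebra
  haveI : IsScalarTower P.F T.F T.K := IsScalarTower.of_algebraMap_eq fun _ => rfl
  set u := placeOf X pp.1 x with hudef
  have hpu : ((pp : ℕ) : 𝓞 T.K) ∈ u.asIdeal := natCast_mem_placeOf X pp.1 x
  have hfb : finBelow P.F T.K u = finBelow P.F T.F (finBelow T.F T.K u) :=
    HeightOneSpectrum.ext (Ideal.under_under (B := 𝓞 T.F) u.asIdeal).symm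
  -- `e = e(u | ℤ) = e(v | p) · e(u | v) = e(u | v)`
  have hekOf : absRamificationIdx (pp : ℕ) (kOf X pp.1 x) = u.asIdeal.ramificationIdx ℤ := by
    rw [show absRamificationIdx (pp : ℕ) (kOf X pp.1 x) = absRamificationIdx (pp : ℕ) (RescaledCompletion T.K pp.1 u hpu) from rfl,
      absRamificationIdx_rescaledCompletion]
  have heuv : (finBelow P.F T.K u).asIdeal.ramificationIdx' u.asIdeal = e := by
    have h1 : u.asIdeal.ramificationIdx ℤ =
        ramIdx P.F (u.under (𝓞 P.F)) * Ideal.ramificationIdx' (u.under (𝓞 P.F)).asIdeal u.asIdeal :=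
      ThetaData.absRamificationIdx_eq_ramIdx_mul (F := P.F) u
    have h2 : u.under (𝓞 P.F) = finBelow P.F T.K u := (finBelow_eq_under P.F T.K u).symm
    rw [h2, hfb, hv1, one_mul, ← hfb] at h1
    rw [← he, hekOf, h1]
  -- `P_q(u) = −ord_u(j_E)/(2l)` and `ord_u(j_E) = e(u|v)·ord_v j(λ)`
  have hjK : X.jE = algebraMap P.F T.K (Cor22.jInv P.x) := by
    rw [show X.jE = algebraMap T.F T.K T.E.j from rfl, T.j_eq, ← IsScalarTower.algebraMap_apply]
  rw [X.qPilot_apply_of_mem hx, pilotDataOfK_l]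
  unfold PilotData.ordq
  rw [hjK, Cor22.ord_algebraMap_eq u (Cor22.jInv P.x)]
  have hord' : ord P.F (finBelow P.F T.K u) (Cor22.jInv P.x) = -(h : ℤ) := by rw [hfb]; exact hord
  rw [hord', heuv]
  push_cast
  ring

/-- **`e(K_x/ℚ_p) = l·m` with `30 ∣ m·h`** at a bad fibre point `x | p` (`p ∉ {2, l}`) over a place `v` of `F_tpd` UNRAMIFIED over `p` with
`ord_v j(λ) = −h`: `m = e(w|v)` for the place `w` of `F` under `x` — the `l`-division layer `K/F` contributes EXACTLY `l`
(abc-iut-W-neg-1's `ThetaVolumeDatumAt.ramificationIdx_int_eq_mul_prime`), `e(w|p) = e(v|p)·e(w|v) = e(w|v)`, and `30 ∣ e(w|v)·ord_v j(λ)`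
(the `30`-th root of the Tate parameter in `F_w`, `ThetaVolumeDatumAt.thirty_dvd_ramificationIdx_mul_ord`).
[cite: Mochizuki2012, IUTchI Ex. 3.2 (iv) p. 71; IUTchIV Thm. 1.10 p. 22] [cite: SilvermanATAEC1994, V.5 Thm. 5.3 and Cor. 5.4] [claim: Mochizuki2012, status: disputed] -/
theorem GenuineK.exists_absRamificationIdx_kOf_eq_prime_mul_tpd {P : NFPoint} {l : ℕ} (T : Cor22.ThetaVolumeDatumAt P l)
    (pp : Nat.Primes) (hp2 : (pp : ℕ) ≠ 2) (hpl : (pp : ℕ) ≠ l) :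
    letI := T.instFieldF; letI := T.instNumberFieldF; letI := T.instAlgebraF; letI := T.instFieldK
    letI := T.instNumberFieldK; letI := T.instAlgebraK; letI := T.instFieldFbar; letI := T.instAlgebraFbar
    letI := T.instAlgebraKFbar; letI := T.instIsElliptic
    haveI : Fact (pp : ℕ).Prime := ⟨pp.2⟩
    ∀ (x : (thetaIndex (pilotDataOfK T.D T.K)).Fibre (.inr pp)) {h : ℕ},
      ramIdx P.F (finBelow P.F T.F (finBelow T.F T.K (placeOf (pilotDataOfK T.D T.K) pp.1 x))) = 1 →
      ord P.F (finBelow P.F T.F (finBelow T.F T.K (placeOf (pilotDataOfK T.D T.K) pp.1 x))) (Cor22.jInv P.x) = -(h : ℤ) →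
      0 < h →
      ∃ m : ℕ, absRamificationIdx (pp : ℕ) (kOf (pilotDataOfK T.D T.K) pp.1 x) = l * m ∧ 30 ∣ m * h := by
  letI := T.instFieldF; letI := T.instNumberFieldF; letI := T.instAlgebraF; letI := T.instFieldK
  letI := T.instNumberFieldK; letI := T.instAlgebraK; letI := T.instFieldFbar; letI := T.instAlgebraFbar
  letI := T.instAlgebraKFbar; letI := T.instIsElliptic
  haveI : Fact (pp : ℕ).Prime := ⟨pp.2⟩
  set X := pilotDataOfK T.D T.K with hXdef
  intro x h hv1 hord hh
  set u := placeOf X pp.1 x with hudef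
  set w := finBelow T.F T.K u with hwdef
  set v := finBelow P.F T.F w with hvdef
  have hpu : ((pp : ℕ) : 𝓞 T.K) ∈ u.asIdeal := natCast_mem_placeOf X pp.1 x
  have huchar : residueChar T.K u = (pp : ℕ) := residueChar_eq_of_natCast_mem pp.1 hpu
  have hu : residueChar T.K u ∉ ({2, l} : Finset ℕ) := by
    rw [huchar]
    simp only [Finset.mem_insert, Finset.mem_singleton, not_or]
    exact ⟨hp2, hpl⟩
  have hbad : v ∈ Cor22.badPlaces P := by
    rw [Cor22.mem_badPlaces_iff_ord_neg, hvdef, hwdef, hord]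
    have : (0 : ℤ) < h := by exact_mod_cast hh
    linarith
  have hekOf : absRamificationIdx (pp : ℕ) (kOf X pp.1 x) = u.asIdeal.ramificationIdx ℤ := by
    rw [show absRamificationIdx (pp : ℕ) (kOf X pp.1 x) = absRamificationIdx (pp : ℕ) (RescaledCompletion T.K pp.1 u hpu) from rfl,
      absRamificationIdx_rescaledCompletion]
  -- `e(u | ℤ) = e(w | ℤ) · l`
  have hul : u.asIdeal.ramificationIdx ℤ = w.asIdeal.ramificationIdx ℤ * l := T.ramificationIdx_int_eq_mul_prime u hu hbad
  -- `e(w | ℤ) = e(v | p) · e(w | v) = e(w | v)`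
  haveI : v.asIdeal.IsMaximal := v.isMaximal
  have hwv : w.asIdeal.ramificationIdx ℤ = w.asIdeal.ramificationIdx (𝓞 P.F) := by
    have h1 : w.asIdeal.ramificationIdx ℤ =
        ramIdx P.F (w.under (𝓞 P.F)) * Ideal.ramificationIdx' (w.under (𝓞 P.F)).asIdeal w.asIdeal :=
      ThetaData.absRamificationIdx_eq_ramIdx_mul (F := P.F) w
    have h2 : w.under (𝓞 P.F) = v := (finBelow_eq_under P.F T.F w).symm
    rw [h2, hv1, one_mul, Ideal.ramificationIdx'_eq_ramificationIdx v.asIdeal w.asIdeal v.ne_bot] at h1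
    exact h1
  -- `30 ∣ e(w | v) · h`
  have h30 : (30 : ℤ) ∣ (w.asIdeal.ramificationIdx (𝓞 P.F) : ℤ) * ord P.F (finBelow P.F T.F w) (Cor22.jInv P.x) :=
    T.thirty_dvd_ramificationIdx_mul_ord w hbad
  rw [← hvdef, hord] at h30
  have h30' : (30 : ℤ) ∣ ((w.asIdeal.ramificationIdx (𝓞 P.F) * h : ℕ) : ℤ) := by
    have : (w.asIdeal.ramificationIdx (𝓞 P.F) : ℤ) * -(h : ℤ) = -(((w.asIdeal.ramificationIdx (𝓞 P.F) * h : ℕ) : ℤ)) := by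
      push_cast; ring
    rw [this, dvd_neg] at h30
    exact h30
  refine ⟨w.asIdeal.ramificationIdx (𝓞 P.F), ?_, by exact_mod_cast h30'⟩
  rw [hekOf, hul, hwv, mul_comm]

end Summit.ABC.IUTFork.Conditional

end
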